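import Summits.CriticalPhenomena.Ising3D.Control2DOpePMidA
import HarnessLib

/-!
# The 2D control: obligations (T) and (M) of the `c`-bound certificate `opeP` IN THE KERNEL — part B
(cell `pub-ising3x`, seat controls-1; continuation of `Control2DOpePMidA.lean`)

HONEST FRAMING: lottery ticket; floor = tightest certified 3D Ising CFT bounds; no exact-solution
claim without a proof.

The remaining three kernel chunks of the (M) check for `opeP` (`j = 34 … 119`) and the assembly:
`opeP_pairMid`, **`opeP_pairPositiveAbove : PairPositiveAbove opeP_φ (1/8) 24`** (with the kernel (T) of
part A), and `opeBound_opeP_of_C` / `centralCharge_opeP_of_C` — the `c > 0.4969` certificate conditional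
ONLY on its `Δ`-cells (C) below `E₀ = 24`.
-/

namespace Summit.CriticalPhenomena.Ising3D.Control2D.RB0

open Set Finset
open Literature.MathematicalPhysics.QuantumFieldTheory.ConformalBootstrap3D
open Summit.CriticalPhenomena.Ising3D.Control2D

set_option maxHeartbeats 10000000 in
set_option maxRecDepth 200000 in
/-- (M) of `opeP`, indices `j = 34 … 43`. [folklore] -/
theorem opeP_mid_run3 : checkRange 80 opeP_mdata opeP_exc 24 120 34 10 = true := by
  decide +kernel

set_option maxHeartbeats 10000000 in
set_option maxRecDepth 200000 in
/-- (M) of `opeP`, indices `j = 44 … 65`. [folklore] -/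
theorem opeP_mid_run4 : checkRange 80 opeP_mdata opeP_exc 24 120 44 22 = true := by
  decide +kernel

set_option maxHeartbeats 10000000 in
set_option maxRecDepth 200000 in
/-- (M) of `opeP`, indices `j = 66 … 119`. [folklore] -/
theorem opeP_mid_run5 : checkRange 80 opeP_mdata opeP_exc 24 120 66 54 = true := by
  decide +kernel

/-- Every index `j < 120` passes the (M) checker for `opeP`. [folklore] -/
theorem opeP_checkJ_all : ∀ j < 120, checkJ 80 opeP_mdata opeP_exc 24 120 j = true := by
  intro j hj
  rcases lt_or_ge j 16 with h0 | h0
  · exact checkRange_sound opeP_mid_run0 j (by omega) (by omega)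
  rcases lt_or_ge j 25 with h1 | h1
  · exact checkRange_sound opeP_mid_run1 j (by omega) (by omega)
  rcases lt_or_ge j 34 with h2 | h2
  · exact checkRange_sound opeP_mid_run2 j (by omega) (by omega)
  rcases lt_or_ge j 44 with h3 | h3
  · exact checkRange_sound opeP_mid_run3 j (by omega) (by omega)
  rcases lt_or_ge j 66 with h4 | h4
  · exact checkRange_sound opeP_mid_run4 j (by omega) (by omega)
  · exact checkRange_sound opeP_mid_run5 j h4 (by omega)

/-- **(M) for `opeP`, in the kernel**: `φ[F_-[x^a y^b + x^b y^a]] ≥ 0` for `a, b ≥ 0`, `24 ≤ a + b < 120`,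
`a - b ∈ ℤ`. [folklore] -/
theorem opeP_pairMid : ∀ a b : ℝ, 0 ≤ a → 0 ≤ b → (24 : ℝ) ≤ a + b → a + b < 120 →
    (∃ j : ℤ, a - b = j) → 0 ≤ opeP_φ (crossF (1 / 8) (-1) (pairPow a b)) := by
  intro a b ha hb hE hD hj
  exact pair_nonneg_of_checkAll opeP_w opeP_z opeP_zb opeP_z_bounds opeP_zb_bounds
    80 7 24 120 opeP_exc opeP_checkJ_all a b ha hb (by exact_mod_cast hE) (by exact_mod_cast hD) hj

/-- **(T)+(M) for `opeP` in the kernel**: `PairPositiveAbove φ (1/8) 24`. [folklore] -/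
theorem opeP_pairPositiveAbove : PairPositiveAbove opeP_φ (1 / 8) 24 :=
  PairPositiveAbove.of_split opeP_pairMid opeP_pairPositiveAbove_tail

/-- **Certificate `opeP` with (I′), (T) and (M) in the kernel**: `OpeBound (1/8) (3/10) (12402/788797)`
conditional only on the `Δ`-cells (C) below `E₀ = 24`. [folklore] -/
theorem opeBound_opeP_of_C
    (hC₀ : CellPositive opeP_φ (1 / 8) 0 (3/10) 24)
    (hC : ∀ ℓ : ℕ, Even ℓ → ℓ ≠ 0 → (ℓ : ℝ) < 24 → CellPositive opeP_φ (1 / 8) ℓ ℓ 24) :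
    OpeBound (1 / 8) (3/10) (12402/788797) :=
  opeBound_opeP_of_CMT hC₀ hC opeP_pairPositiveAbove

/-- **The `c` reading with (I′), (T), (M) in the kernel**: under the (C) cells, every solution with a
stress tensor of Ward-identity coefficient has `c > 788797/1587456 ≈ 0.496894`. [folklore] -/
theorem centralCharge_opeP_of_C
    (hC₀ : CellPositive opeP_φ (1 / 8) 0 (3/10) 24)
    (hC : ∀ ℓ : ℕ, Even ℓ → ℓ ≠ 0 → (ℓ : ℝ) < 24 → CellPositive opeP_φ (1 / 8) ℓ ℓ 24)
    (D : CrossingData) (hU : D.IsUnitary) (hX : D.SatisfiesCrossing (1 / 8)) (hgap : D.HasScalarGap (3/10))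
    {c : ℝ} (hc : 0 < c) (i : D.ι) (hΔ : D.Δ i = 2) (hspin : D.spin i = 2)
    (hWard : D.p i = (1 / 8 : ℝ) ^ 2 / (2 * c)) :
    (788797/1587456 : ℝ) < c :=
  centralCharge_opeP_of_CMT hC₀ hC opeP_pairPositiveAbove D hU hX hgap hc i hΔ hspin hWard

end Summit.CriticalPhenomena.Ising3D.Control2D.RB0
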